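import Literature.NumberTheory.EllipticCurves.BSDSelmerParityDokchitserBaseChangeProofs
import Summits.BirchSwinnertonDyer.BirchSwinnertonDyer.Theorems.KolyvaginRankRigidityAtTwoCorankFromFiniteLevels
import HarnessLib

/-!
# Crux V2 `KolyvaginCorankRigidityAtTwo` (stmt-BirchSwinnertonDyer-23949), line `kolyvagin-depth-split`,
# stub `stub_lowerBoundMinimalPosDepth`, step (S3): `τ`-EIGENVECTORS of `Sel_{p^∞}(E/K)` come from
# `Sel_{p^∞}(E/ℚ)` resp. `Sel_{p^∞}(E^{(c)}/ℚ)` up to the multiplier `8`, at EVERY prime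

Kolyvagin's lower bound (Math. Ann. 291 (1991), Thm. 2.2–2.3; W. Zhang 2014, Lemma 8.4) produces
Selmer classes over `K` that are EIGENVECTORS of complex conjugation of one sign and reads a
corank over `ℚ` off them. For `p` odd one uses `H¹(K,·) = H¹⁺ ⊕ H¹⁻`, which fails at `p = 2`;
for eigenVECTORS no decomposition is needed: `cor ∘ res = 2`, `res ∘ cor = 1 + c_*`
(`H1CorestrictionIndexTwo`) give `res (cor ζ) = 2ζ` for `c_* ζ = ζ` and
`ψ_* res (cor ψ_*⁻¹ ζ) = 2ζ` for `c_* ζ = -ζ`. Contents (all `p`, then counting at `p = 2`):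
`exists_res_eq_nsmul_of_conjH1_eq` / `…_neg` (generic `IndexTwoDecompositionData`: fixed resp.
anti-fixed `ζ ∈ T` has `2^{a+1} ζ ∈ res S` resp. `∈ ψ_* res S'`);
`exists_resPrimary_eq_eight_nsmul_of_conj_eq` / `…_neg` (Selmer groups, `decompData`, `a = 2`);
`natCard_le_of_conj_eq` / `…_neg` (`#B ≤ #Sel_{2^∞}(E/K)[8] · #Sel_{2^∞}(X/ℚ)[2^{M+1}]` for a
finite eigen-subgroup `B` killed by `2^M`); `lowerBound_of_eigenGrowthOverK` (with the landed
`le_selmerCorank_of_pow_le_natCard`, p595706: eigen-growth over `K` ⇒ `ν + 1 ≤ c ∨ ν + 1 ≤ c'`).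
So the research content of the stub is isolated OVER `K` (the triangular system at `2`).
HONEST FRAMING: no Heegner points here; BSD is not proved; the stub stays open.
Refs: Serre, *Galois Cohomology*, I.§2.4; Dokchitser–Dokchitser, Ann. of Math. 172 (2010),
Lemma 4.14 (proof); Kolyvagin, Math. Ann. 291 (1991), §2 (the groups `S^ν`).
-/

set_option autoImplicit false
-- the Theorems namespace of this sub repeats the summit name by design (D-0017 nested layout)
set_option linter.dupNamespace false

noncomputable section

open scoped Classical AddSubgroup

open WeierstrassCurve Literature.NumberTheory.EllipticCurves
  Literature.NumberTheory.GaloisRepresentations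

namespace Summit.BirchSwinnertonDyer.BirchSwinnertonDyer.Theorems.KolyvaginRankRigidity

universe u

/-! ## Generic: eigenvectors in an index-two decomposition datum -/
section Generic

variable {G : Type u} [Group G] [TopologicalSpace G] [IsTopologicalGroup G]
variable {N : Subgroup G} [N.Normal] {c : G}
variable {M : Type u} [AddCommGroup M] [DistribMulAction G M] [TopologicalSpace M]
  [DiscreteTopology M]
variable {M' : Type u} [AddCommGroup M'] [DistribMulAction G M'] [TopologicalSpace M']
  [DiscreteTopology M']
variable (D : IndexTwoDecompositionData N c M M')

/-- **`c_*`-FIXED classes of `T` come from `S`, up to `2^{a+1}`** (`η = 2^a cor ζ ∈ S` as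
`res cor ζ = ζ + c_* ζ ∈ T`; `res η = 2^{a+1} ζ`). Serre, *Galois Cohomology*, I.§2.4. [folklore] -/
theorem exists_res_eq_nsmul_of_conjH1_eq (ζ : D.T)
    (hfix : conjH1 N M c (ζ : subgroupH1 N M) = ζ) :
    ∃ η ∈ D.S, resSubgroupH1 N M η = 2 ^ (D.a + 1) • (ζ : subgroupH1 N M) := by
  have hN := D.isOpen
  have hM := D.continuous_smul
  have hc := D.xor
  set z : subgroupH1 N M := (ζ : subgroupH1 N M) with hz
  set η := corH1 hN hM hc z with hη
  have hres : resSubgroupH1 N M η = z + conjH1 N M c z := resSubgroupH1_corH1 hN hM hc z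
  have hS : 2 ^ D.a • η ∈ D.S := D.mem_of_res_mem η (by
    rw [hres]; exact D.T.add_mem ζ.2 (D.conj_mem _ ζ.2))
  refine ⟨2 ^ D.a • η, hS, ?_⟩
  rw [map_nsmul, hres, hfix, ← two_nsmul, smul_smul, pow_succ]

/-- **`c_*`-ANTI-FIXED classes of `T` come from `S'`, up to `2^{a+1}`** (`η' = 2^a cor ψ_*⁻¹ ζ`,
`ψ_* res η' = 2^a (ζ - c_* ζ) = 2^{a+1} ζ`). Serre, *Galois Cohomology*, I.§2.4. [folklore] -/
theorem exists_res'_eq_nsmul_of_conjH1_eq_neg (ζ : D.T)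
    (hanti : conjH1 N M c (ζ : subgroupH1 N M) = -ζ) :
    ∃ η' ∈ D.S', h1Equiv D.ψ D.hψ (resSubgroupH1 N M' η') =
      2 ^ (D.a + 1) • (ζ : subgroupH1 N M) := by
  have hN := D.isOpen
  have hM' := D.continuous_smul'
  have hc := D.xor
  set z : subgroupH1 N M := (ζ : subgroupH1 N M) with hz
  set ξ' := (h1Equiv D.ψ D.hψ).symm z with hξ'
  set η' := corH1 hN hM' hc ξ' with hη'
  have hres' : h1Equiv D.ψ D.hψ (resSubgroupH1 N M' η') = z - conjH1 N M c z := by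
    rw [hη', resSubgroupH1_corH1, map_add, h1Equiv_conjH1_neg D.ψ D.hψ D.hψc, hξ',
      AddEquiv.apply_symm_apply, sub_eq_add_neg]
  have hS' : 2 ^ D.a • η' ∈ D.S' := D.mem_of_res_mem' η' (by
    rw [hres']; exact D.T.sub_mem ζ.2 (D.conj_mem _ ζ.2))
  refine ⟨2 ^ D.a • η', hS', ?_⟩
  rw [map_nsmul, map_nsmul, hres', hanti, sub_neg_eq_add, ← two_nsmul, smul_smul, pow_succ]

end Generic

/-! ## Selmer groups: `E/ℚ`, `K = ℚ(θ)`, `θ² = c`, any prime `p` -/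
section Selmer

open NumberField

variable (W : WeierstrassCurve ℚ) (K : Type) [Field K] [NumberField K] (h2 : Module.finrank ℚ K = 2)
  {θ : K} {c : ℚ} (hθ : θ ∉ Set.range (algebraMap ℚ K)) (hc : θ ^ 2 = algebraMap ℚ K c) (p : ℕ)

include h2 in
/-- **`τ`-invariant classes of `Sel_{p^∞}(E/K)` come from `Sel_{p^∞}(E/ℚ)` up to `8`.** For
`s ∈ Sel_{p^∞}(E/K)` fixed by the action `τ₀_*` of (the chosen lift of) the non-trivial
automorphism of `K`, there is `η ∈ Sel_{p^∞}(E/ℚ)` with `res η = 8 s`. (The decomposition datum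
`decompData` has `a = 2`: `res η` Selmer over `K` forces `4η` Selmer over `ℚ`.)
[cite: DokchitserDokchitserAnnals2010, Lemma 4.14 (proof)] -/
theorem exists_resPrimary_eq_eight_nsmul_of_conj_eq (s : galH1Primary (W.baseChange K) p)
    (hs : s ∈ selmerGroupPInfty (W.baseChange K) p)
    (hfix : (isLiftOfAut_liftAut (sigmaQ K h2 hθ hc)).conjH1Primary W p s = s) :
    ∃ η ∈ selmerGroupPInfty W p, resPrimary W K p η = 8 • s := by
  haveI : IsGalois ℚ K := isGalois_of_finrank_eq_two K h2
  haveI := normal_galRange K h2 (sigmaQ_ne_one K h2 hθ hc)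
  set D := decompData W K h2 hθ hc p with hD
  have hsT : modelIso K W p s ∈ D.T :=
    ⟨s, (W.baseChange K).selmerGroupPInfty_le_finSelmerGroupPInfty p hs, rfl⟩
  have hfix' : conjH1 (galRange (K := ℚ) K) (geomPrimaryTorsion W p)
      (liftToAbsGal (K := ℚ) K (sigmaQ K h2 hθ hc)) (modelIso K W p s) = modelIso K W p s := by
    rw [← modelIso_conjH1Primary K W p (sigmaQ K h2 hθ hc) h2 (sigmaQ_ne_one K h2 hθ hc), hfix]
  obtain ⟨η, hη, hres⟩ := exists_res_eq_nsmul_of_conjH1_eq D ⟨_, hsT⟩ hfix'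
  refine ⟨η, hη, (modelIso K W p).injective ?_⟩
  have h8 : (2 : ℕ) ^ (D.a + 1) = 8 := by rw [hD]; rfl
  rw [modelIso_resPrimary, map_nsmul, ← h8, ← hres]
  rfl

include h2 in
/-- **`τ`-anti-invariant classes of `Sel_{p^∞}(E/K)` come from `Sel_{p^∞}(E^{(c)}/ℚ)` up to
`8`**: if `τ₀_* s = -s` then `8 s = ψ_K (res η')` for some `η' ∈ Sel_{p^∞}(E^{(c)}/ℚ)`, `ψ_K`
the twist isomorphism over `K` (`hPsiK`). [cite: DokchitserDokchitserAnnals2010, Lemma 4.14 (proof)] -/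
theorem exists_resPrimary_eq_eight_nsmul_of_conj_eq_neg (s : galH1Primary (W.baseChange K) p)
    (hs : s ∈ selmerGroupPInfty (W.baseChange K) p)
    (hanti : (isLiftOfAut_liftAut (sigmaQ K h2 hθ hc)).conjH1Primary W p s = -s) :
    ∃ η' ∈ selmerGroupPInfty (W.quadraticTwist c) p,
      hPsiK W K hθ hc p (resPrimary (W.quadraticTwist c) K p η') = 8 • s := by
  haveI : IsGalois ℚ K := isGalois_of_finrank_eq_two K h2
  haveI := normal_galRange K h2 (sigmaQ_ne_one K h2 hθ hc)
  set D := decompData W K h2 hθ hc p with hD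
  have hsT : modelIso K W p s ∈ D.T :=
    ⟨s, (W.baseChange K).selmerGroupPInfty_le_finSelmerGroupPInfty p hs, rfl⟩
  have hanti' : conjH1 (galRange (K := ℚ) K) (geomPrimaryTorsion W p)
      (liftToAbsGal (K := ℚ) K (sigmaQ K h2 hθ hc)) (modelIso K W p s) = -modelIso K W p s := by
    rw [← modelIso_conjH1Primary K W p (sigmaQ K h2 hθ hc) h2 (sigmaQ_ne_one K h2 hθ hc), hanti,
      map_neg]
  obtain ⟨η', hη', hres⟩ := exists_res'_eq_nsmul_of_conjH1_eq_neg D ⟨_, hsT⟩ hanti'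
  refine ⟨η', hη', (modelIso K W p).injective ?_⟩
  have h8 : (2 : ℕ) ^ (D.a + 1) = 8 := by rw [hD]; rfl
  rw [← h1Equiv_psiQ_modelIso, modelIso_resPrimary, map_nsmul, ← h8, ← hres]
  rfl

include h2 hθ hc in
/-- The kernel of `res : H¹(ℚ, E[p^∞]) → H¹(K, E[p^∞])` is killed by `2` (`cor ∘ res = 2`).
Serre, *Galois Cohomology*, I.§2.4. [folklore] -/
theorem two_nsmul_eq_zero_of_resPrimary_eq_zero {η : galH1Primary W p}
    (hη : resPrimary W K p η = 0) : 2 • η = 0 := by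
  haveI : IsGalois ℚ K := isGalois_of_finrank_eq_two K h2
  haveI := normal_galRange K h2 (sigmaQ_ne_one K h2 hθ hc)
  have h0 : resSubgroupH1 (galRange (K := ℚ) K) (geomPrimaryTorsion W p) η = 0 := by
    have h := modelIso_resPrimary K W p η
    rw [hη, map_zero] at h
    exact h.symm
  exact two_nsmul_eq_zero_of_resSubgroupH1_eq_zero (isOpen_galRange K)
    (continuous_smul_geomPrimaryTorsion W p)
    (xor_galRange K h2 (sigmaQ_ne_one K h2 hθ hc)) h0

end Selmer

/-! ## Counting at `p = 2` -/
section Counting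

open NumberField

variable (W : WeierstrassCurve ℚ) (K : Type) [Field K] [NumberField K]
  (h2 : Module.finrank ℚ K = 2) {θ : K} {c : ℚ} (hθ : θ ∉ Set.range (algebraMap ℚ K))
  (hc : θ ^ 2 = algebraMap ℚ K c)

/-- **Abstract counting step**: `t : H¹(ℚ, X[2^∞]) → H¹(K, E[2^∞])` additive with `ker t`
killed by `2`; `B ≤ Sel_{2^∞}(E/K)` finite, killed by `2^M`, every `8b` of the form `t η`,
`η ∈ Sel_{2^∞}(X/ℚ)` ⇒ `#B ≤ #Sel_{2^∞}(E/K)[8] · #Sel_{2^∞}(X/ℚ)[2^{M+1}]`. [folklore] -/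
theorem natCard_le_of_transfer (X : WeierstrassCurve ℚ)
    (t : galH1Primary X 2 →+ galH1Primary (W.baseChange K) 2)
    (ht : ∀ η, t η = 0 → 2 • η = 0)
    (B : AddSubgroup (galH1Primary (W.baseChange K) 2)) [Finite B]
    (hB : B ≤ selmerGroupPInfty (W.baseChange K) 2)
    {M : ℕ} (hM : ∀ b ∈ B, 2 ^ M • b = 0)
    (htr : ∀ b ∈ B, ∃ η ∈ selmerGroupPInfty X 2, t η = 8 • b)
    [Finite (selmerGroupPInfty (W.baseChange K) 2)[((2 ^ 3 : ℕ) : ℤ)]]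
    [Finite (selmerGroupPInfty X 2)[((2 ^ (M + 1) : ℕ) : ℤ)]] :
    Nat.card B ≤ Nat.card (selmerGroupPInfty (W.baseChange K) 2)[((2 ^ 3 : ℕ) : ℤ)] *
      Nat.card (selmerGroupPInfty X 2)[((2 ^ (M + 1) : ℕ) : ℤ)] := by
  -- choose `η_b ∈ Sel(X/ℚ)[2^{M+1}]` with `t η_b = 8 b`
  have key : ∀ b ∈ B, ∃ η : (selmerGroupPInfty X 2)[((2 ^ (M + 1) : ℕ) : ℤ)],
      t ((η : selmerGroupPInfty X 2) : galH1Primary X 2) = 8 • b := by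
    intro b hb
    obtain ⟨η, hη, hres⟩ := htr b hb
    have h2M : 2 ^ (M + 1) • η = 0 := by
      have h0 : t (2 ^ M • η) = 0 := by
        rw [map_nsmul, hres, smul_comm, hM b hb, smul_zero]
      have := ht _ h0
      rwa [smul_smul, ← pow_succ'] at this
    exact ⟨⟨⟨η, hη⟩, AddSubgroup.torsionBy.nsmul_iff.mpr (Subtype.ext (by
      rw [AddSubmonoidClass.coe_nsmul, ZeroMemClass.coe_zero]; exact h2M))⟩, hres⟩
  classical
  let g : galH1Primary (W.baseChange K) 2 → (selmerGroupPInfty X 2)[((2 ^ (M + 1) : ℕ) : ℤ)] :=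
    fun r ↦ if h : ∃ b ∈ B, 8 • b = r then Classical.choose (key _ (Classical.choose_spec h).1)
      else 0
  have hg : ∀ b ∈ B, ∀ b' ∈ B, g (8 • b) = g (8 • b') → 8 • b = 8 • b' := by
    intro b hb b' hb' hgg
    have hb8 : ∃ x ∈ B, 8 • x = 8 • b := ⟨b, hb, rfl⟩
    have hb8' : ∃ x ∈ B, 8 • x = 8 • b' := ⟨b', hb', rfl⟩
    simp only [g, dif_pos hb8, dif_pos hb8'] at hgg
    have e1 := Classical.choose_spec (key _ (Classical.choose_spec hb8).1)
    have e2 := Classical.choose_spec (key _ (Classical.choose_spec hb8').1)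
    have e3 := congrArg (fun η : (selmerGroupPInfty X 2)[((2 ^ (M + 1) : ℕ) : ℤ)] ↦
      t ((η : selmerGroupPInfty X 2) : galH1Primary X 2)) hgg
    calc 8 • b = 8 • Classical.choose hb8 := (Classical.choose_spec hb8).2.symm
      _ = _ := e1.symm
      _ = _ := e3
      _ = 8 • Classical.choose hb8' := e2
      _ = 8 • b' := (Classical.choose_spec hb8').2
  -- `#B = #ker (8•) · #8B`
  let φ : B →+ galH1Primary (W.baseChange K) 2 := (nsmulAddMonoidHom 8).comp B.subtype
  have hφ : ∀ b : B, φ b = 8 • (b : galH1Primary (W.baseChange K) 2) := fun b ↦ rfl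
  rw [natCard_eq_card_ker_mul_card_range φ]
  refine Nat.mul_le_mul ?_ ?_
  · -- `ker φ ↪ Sel(E/K)[8]`
    refine Nat.card_le_card_of_injective
      (fun x : φ.ker ↦ (⟨⟨((x : B) : galH1Primary (W.baseChange K) 2), hB (x : B).2⟩,
        AddSubgroup.torsionBy.nsmul_iff.mpr (Subtype.ext ?_)⟩ :
          (selmerGroupPInfty (W.baseChange K) 2)[((2 ^ 3 : ℕ) : ℤ)])) ?_
    · have hx := x.2
      rw [AddMonoidHom.mem_ker, hφ] at hx
      rw [AddSubmonoidClass.coe_nsmul, ZeroMemClass.coe_zero]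
      exact hx
    · intro x y hxy
      exact Subtype.ext (Subtype.ext (congrArg (fun z :
        (selmerGroupPInfty (W.baseChange K) 2)[((2 ^ 3 : ℕ) : ℤ)] ↦ ((z : selmerGroupPInfty
          (W.baseChange K) 2) : galH1Primary (W.baseChange K) 2)) hxy))
  · -- `8B ↪ Sel(X/ℚ)[2^{M+1}]` via `g`
    refine Nat.card_le_card_of_injective (fun r : φ.range ↦ g r) ?_
    rintro ⟨r, hr⟩ ⟨r', hr'⟩ h
    obtain ⟨b, rfl⟩ := hr
    obtain ⟨b', rfl⟩ := hr'
    change g (φ b) = g (φ b') at h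
    apply Subtype.ext
    change φ b = φ b'
    rw [hφ, hφ] at h ⊢
    exact hg _ b.2 _ b'.2 h

include h2 in
/-- **COUNTING, invariant case (`p = 2`).** A finite subgroup `B ≤ Sel_{2^∞}(E/K)` of
`τ`-INVARIANT classes killed by `2^M` has `#B ≤ #Sel_{2^∞}(E/K)[8] · #Sel_{2^∞}(E/ℚ)[2^{M+1}]`
(constant independent of `M`) — the `p = 2` substitute for "`S^ν_{2^n}` is the Selmer group of
`E^ν` over `ℚ`" (Kolyvagin 1991, §2, p. 258, odd `ℓ`). [cite: Kolyvagin1991MathAnn, §2 (the groups S^ν)] -/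
theorem natCard_le_of_conj_eq (B : AddSubgroup (galH1Primary (W.baseChange K) 2)) [Finite B]
    (hB : B ≤ selmerGroupPInfty (W.baseChange K) 2)
    (hfix : ∀ b ∈ B, (isLiftOfAut_liftAut (sigmaQ K h2 hθ hc)).conjH1Primary W 2 b = b)
    {M : ℕ} (hM : ∀ b ∈ B, 2 ^ M • b = 0)
    [Finite (selmerGroupPInfty (W.baseChange K) 2)[((2 ^ 3 : ℕ) : ℤ)]]
    [Finite (selmerGroupPInfty W 2)[((2 ^ (M + 1) : ℕ) : ℤ)]] :
    Nat.card B ≤ Nat.card (selmerGroupPInfty (W.baseChange K) 2)[((2 ^ 3 : ℕ) : ℤ)] *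
      Nat.card (selmerGroupPInfty W 2)[((2 ^ (M + 1) : ℕ) : ℤ)] :=
  natCard_le_of_transfer W K W (resPrimary W K 2)
    (fun _ h ↦ two_nsmul_eq_zero_of_resPrimary_eq_zero W K h2 hθ hc 2 h) B hB hM
    (fun b hb ↦ exists_resPrimary_eq_eight_nsmul_of_conj_eq W K h2 hθ hc 2 b (hB hb) (hfix b hb))

include h2 in
/-- **COUNTING, anti-invariant case (`p = 2`).** A finite subgroup `B ≤ Sel_{2^∞}(E/K)` of
`τ`-ANTI-INVARIANT classes killed by `2^M` has
`#B ≤ #Sel_{2^∞}(E/K)[8] · #Sel_{2^∞}(E^{(c)}/ℚ)[2^{M+1}]`.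
[cite: Kolyvagin1991MathAnn, §2 (the groups S^ν)] -/
theorem natCard_le_of_conj_eq_neg (B : AddSubgroup (galH1Primary (W.baseChange K) 2)) [Finite B]
    (hB : B ≤ selmerGroupPInfty (W.baseChange K) 2)
    (hanti : ∀ b ∈ B, (isLiftOfAut_liftAut (sigmaQ K h2 hθ hc)).conjH1Primary W 2 b = -b)
    {M : ℕ} (hM : ∀ b ∈ B, 2 ^ M • b = 0)
    [Finite (selmerGroupPInfty (W.baseChange K) 2)[((2 ^ 3 : ℕ) : ℤ)]]
    [Finite (selmerGroupPInfty (W.quadraticTwist c) 2)[((2 ^ (M + 1) : ℕ) : ℤ)]] :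
    Nat.card B ≤ Nat.card (selmerGroupPInfty (W.baseChange K) 2)[((2 ^ 3 : ℕ) : ℤ)] *
      Nat.card (selmerGroupPInfty (W.quadraticTwist c) 2)[((2 ^ (M + 1) : ℕ) : ℤ)] := by
  refine natCard_le_of_transfer W K (W.quadraticTwist c)
    ((hPsiK W K hθ hc 2).toAddMonoidHom.comp (resPrimary (W.quadraticTwist c) K 2))
    (fun η h ↦ ?_) B hB hM (fun b hb ↦ ?_)
  · have h0 : resPrimary (W.quadraticTwist c) K 2 η = 0 := (hPsiK W K hθ hc 2).injective (by
      rw [map_zero]; exact h)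
    exact two_nsmul_eq_zero_of_resPrimary_eq_zero (W.quadraticTwist c) K h2 hθ hc 2 h0
  · obtain ⟨η', hη', h⟩ :=
      exists_resPrimary_eq_eight_nsmul_of_conj_eq_neg W K h2 hθ hc 2 b (hB hb) (hanti b hb)
    exact ⟨η', hη', h⟩

end Counting

/-! ## In V2's currency: eigen-growth over `K` ⇒ corank over `ℚ` -/

section Growth

open NumberField

variable (W : WeierstrassCurve ℚ) [W.IsElliptic] (K : Type) [Field K] [NumberField K]
  (h2 : Module.finrank ℚ K = 2) {θ : K} {c : ℚ} (hθ : θ ∉ Set.range (algebraMap ℚ K))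
  (hc : θ ^ 2 = algebraMap ℚ K c)

/-- **Abstract growth transfer (`p = 2`)**: numbers `n_M` with `2^{kM} ≤ C₀ n_M` and
`n_M ≤ D · #Sel_{2^∞}(X/ℚ)[2^{M+1}]` force `k ≤ corank_{ℤ₂} Sel_{2^∞}(X/ℚ)`
(`#Sel[2^{M+1}] ≤ #Sel[2] · #Sel[2^M]` and the landed `le_selmerCorank_of_pow_le_natCard`). [folklore] -/
theorem le_selmerCorank_of_growth_transfer (X : WeierstrassCurve ℚ) [X.IsElliptic] {k C₀ D : ℕ}
    (h : ∀ M : ℕ, ∃ nB : ℕ, 2 ^ (k * M) ≤ C₀ * nB ∧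
      ∀ [Finite (selmerGroupPInfty X 2)[((2 ^ (M + 1) : ℕ) : ℤ)]],
        nB ≤ D * Nat.card (selmerGroupPInfty X 2)[((2 ^ (M + 1) : ℕ) : ℤ)]) :
    k ≤ X.selmerCorank 2 := by
  haveI : Fact (Nat.Prime 2) := ⟨Nat.prime_two⟩
  haveI hf : Finite (selmerGroupPInfty X 2)[((2 : ℕ) : ℤ)] := finite_torsionBy_selmerGroupPInfty X 2
  set D₂ := Nat.card (selmerGroupPInfty X 2)[((2 : ℕ) : ℤ)] with hD₂
  refine le_selmerCorank_of_pow_le_natCard X 2 (C₀ := C₀ * D * D₂) (fun M ↦ ?_)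
  obtain ⟨nB, hk, hB⟩ := h M
  haveI : Finite (selmerGroupPInfty X 2)[((2 ^ (M + 1) : ℕ) : ℤ)] := finite_torsionBy_pow _ 2 (M + 1)
  have hsucc := natCard_torsionBy_pow_succ_le (A := selmerGroupPInfty X 2) 2 M
  calc 2 ^ (k * M) ≤ C₀ * nB := hk
    _ ≤ C₀ * (D * Nat.card (selmerGroupPInfty X 2)[((2 ^ (M + 1) : ℕ) : ℤ)]) :=
        Nat.mul_le_mul_left _ hB
    _ ≤ C₀ * (D * (D₂ * Nat.card (selmerGroupPInfty X 2)[((2 ^ M : ℕ) : ℤ)])) :=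
        Nat.mul_le_mul_left _ (Nat.mul_le_mul_left _ hsucc)
    _ = C₀ * D * D₂ * Nat.card (selmerGroupPInfty X 2)[((2 ^ M : ℕ) : ℤ)] := by ring

include h2 hθ hc in
/-- **Invariant eigen-growth over `K` gives the corank of `E/ℚ` (`p = 2`).** If for every `M`
there is a finite `B_M ≤ Sel_{2^∞}(E/K)` of `τ`-invariant classes killed by `2^M` with
`2^{kM} ≤ C₀ · #B_M`, then `k ≤ corank_{ℤ₂} Sel_{2^∞}(E/ℚ)`. [folklore] -/
theorem le_selmerCorank_of_invariantGrowth {k C₀ : ℕ}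
    (h : ∀ M : ℕ, ∃ B : AddSubgroup (galH1Primary (W.baseChange K) 2), Finite B ∧
      B ≤ selmerGroupPInfty (W.baseChange K) 2 ∧
      (∀ b ∈ B, (isLiftOfAut_liftAut (sigmaQ K h2 hθ hc)).conjH1Primary W 2 b = b) ∧
      (∀ b ∈ B, 2 ^ M • b = 0) ∧ 2 ^ (k * M) ≤ C₀ * Nat.card B) :
    k ≤ W.selmerCorank 2 := by
  haveI : Fact (Nat.Prime 2) := ⟨Nat.prime_two⟩
  haveI : (W.baseChange K).IsElliptic := by rw [baseChange]; infer_instance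
  haveI : Finite (selmerGroupPInfty (W.baseChange K) 2)[((2 : ℕ) : ℤ)] :=
    finite_torsionBy_selmerGroupPInfty (W.baseChange K) 2
  haveI : Finite (selmerGroupPInfty (W.baseChange K) 2)[((2 ^ 3 : ℕ) : ℤ)] :=
    finite_torsionBy_pow _ 2 3
  refine le_selmerCorank_of_growth_transfer W (C₀ := C₀)
    (D := Nat.card (selmerGroupPInfty (W.baseChange K) 2)[((2 ^ 3 : ℕ) : ℤ)]) (fun M ↦ ?_)
  obtain ⟨B, hfin, hB, hfix, hM, hcard⟩ := h M
  haveI := hfin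
  exact ⟨Nat.card B, hcard, fun {_} ↦ natCard_le_of_conj_eq W K h2 hθ hc B hB hfix hM⟩

include h2 hθ hc in
/-- **Anti-invariant eigen-growth over `K` gives the corank of `E^{(c)}/ℚ` (`p = 2`).**
[folklore] -/
theorem le_selmerCorank_twist_of_antiInvariantGrowth {k C₀ : ℕ}
    (h : ∀ M : ℕ, ∃ B : AddSubgroup (galH1Primary (W.baseChange K) 2), Finite B ∧
      B ≤ selmerGroupPInfty (W.baseChange K) 2 ∧
      (∀ b ∈ B, (isLiftOfAut_liftAut (sigmaQ K h2 hθ hc)).conjH1Primary W 2 b = -b) ∧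
      (∀ b ∈ B, 2 ^ M • b = 0) ∧ 2 ^ (k * M) ≤ C₀ * Nat.card B) :
    k ≤ (W.quadraticTwist c).selmerCorank 2 := by
  haveI : Fact (Nat.Prime 2) := ⟨Nat.prime_two⟩
  have hc0 : c ≠ 0 :=
    Literature.NumberTheory.QuadraticFields.Quadratic.sq_ne_zero_of_not_mem_range hθ hc
  haveI : (W.quadraticTwist c).IsElliptic := W.isElliptic_quadraticTwist hc0
  haveI : (W.baseChange K).IsElliptic := by rw [baseChange]; infer_instance
  haveI : Finite (selmerGroupPInfty (W.baseChange K) 2)[((2 : ℕ) : ℤ)] :=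
    finite_torsionBy_selmerGroupPInfty (W.baseChange K) 2
  haveI : Finite (selmerGroupPInfty (W.baseChange K) 2)[((2 ^ 3 : ℕ) : ℤ)] :=
    finite_torsionBy_pow _ 2 3
  refine le_selmerCorank_of_growth_transfer (W.quadraticTwist c) (C₀ := C₀)
    (D := Nat.card (selmerGroupPInfty (W.baseChange K) 2)[((2 ^ 3 : ℕ) : ℤ)]) (fun M ↦ ?_)
  obtain ⟨B, hfin, hB, hanti, hM, hcard⟩ := h M
  haveI := hfin
  exact ⟨Nat.card B, hcard, fun {_} ↦ natCard_le_of_conj_eq_neg W K h2 hθ hc B hB hanti hM⟩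

include h2 hθ hc in
/-- **(S3)+(S4) of `stub_lowerBoundMinimalPosDepth`, in V2's currency.** For `E/ℚ` elliptic and
`K = ℚ(θ)` quadratic, `θ² = c`: if `Sel_{2^∞}(E/K)` contains, for every level `M`, a finite
subgroup `B_M` of complex-conjugation EIGENVECTORS of one fixed sign, killed by `2^M`, with
`2^{(ν+1)M} ≤ C₀ · #B_M` — which is what Kolyvagin's `ν + 1` triangular classes `c_M(n_i)` of
minimal depth `ν` are to provide (the research content, Kolyvagin 1991 Thm. 2.2 / W. Zhang 2014
Lemma 8.4 at `2`) —, then `ν + 1 ≤ corank Sel_{2^∞}(E/ℚ)` or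
`ν + 1 ≤ corank Sel_{2^∞}(E^{(d_K)}/ℚ)` (`E^{(d_K)} ≅ E^{(c)}` over `ℚ` as `d_K = c q²`).
[cite: Kolyvagin1991MathAnn, §2 Thm. 2.2–2.3] [cite: WZhang2014, Lemma 8.4] -/
theorem lowerBound_of_eigenGrowthOverK (ν C₀ : ℕ)
    (h : (∀ M : ℕ, ∃ B : AddSubgroup (galH1Primary (W.baseChange K) 2), Finite B ∧
        B ≤ selmerGroupPInfty (W.baseChange K) 2 ∧
        (∀ b ∈ B, (isLiftOfAut_liftAut (sigmaQ K h2 hθ hc)).conjH1Primary W 2 b = b) ∧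
        (∀ b ∈ B, 2 ^ M • b = 0) ∧ 2 ^ ((ν + 1) * M) ≤ C₀ * Nat.card B) ∨
      (∀ M : ℕ, ∃ B : AddSubgroup (galH1Primary (W.baseChange K) 2), Finite B ∧
        B ≤ selmerGroupPInfty (W.baseChange K) 2 ∧
        (∀ b ∈ B, (isLiftOfAut_liftAut (sigmaQ K h2 hθ hc)).conjH1Primary W 2 b = -b) ∧
        (∀ b ∈ B, 2 ^ M • b = 0) ∧ 2 ^ ((ν + 1) * M) ≤ C₀ * Nat.card B)) :
    ν + 1 ≤ W.selmerCorank 2 ∨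
      ν + 1 ≤ (W.quadraticTwist (NumberField.discr K : ℚ)).selmerCorank 2 := by
  rcases h with h | h
  · exact Or.inl (le_selmerCorank_of_invariantGrowth W K h2 hθ hc h)
  · right
    obtain ⟨q, hq, hd⟩ := NumberField.exists_discr_eq_mul_sq h2 hθ hc
    obtain ⟨C, hC⟩ := W.exists_variableChange_quadraticTwist_mul_sq c q hq
    rw [← hd] at hC
    rw [← selmerCorank_eq_of_variableChange 2 hC]
    exact le_selmerCorank_twist_of_antiInvariantGrowth W K h2 hθ hc h

end Growth

end Summit.BirchSwinnertonDyer.BirchSwinnertonDyer.Theorems.KolyvaginRankRigidity
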